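import Summits.HodgeConjecture.HodgeConjecture.Theorems.F0P3StubBetaOppAdmFold   -- ★ p811784-class K1″ (F0P3-p02 (g5)): `isAdmissible_of_hasFinComponent_of_isHolCotangentAt_cpt`, ★ K1 cone
import HarnessLib

/-!
# Crux `H413` — rung 4 glue for the COTANGENT-GUARDED head (RULING (V30)(1)): letter E2′ `hodgeTypeRigid` from the
# COTANGENT-GUARDED β_opp-adm + `StubF1aCM` — `hodgeTypeRigid_of_betaOppAdmCot_cpt`

F0∕P3 «U3-mult», cell `hodgecm-mathlib`, crux H413 (`stmt-HodgeConjecture-24833`); line of record `Cruxes/H413/Lines/F0_U3LettersRung1.lean` ED. 3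
(`hJ3a_of (hE1c : StubE1coh) (hβo : StubBetaOppAdm) (hF1a : StubF1aCM) (hF1b : StubF1bCM)`, E2′ folded as `hodgeTypeRigid_of_betaOppAdm_cpt hβo hF1a`).
RULING (V30)(1) (F0P3-plan (g4), 2026-08-31T09:55Z): the v4 HEAD of the T5 integrator is COTANGENT-GUARDED — every `P`-binder of (C1♮)∕(C2)∕(C3₀)
carries the ED. 3 frame predicate `P.IsHolCotangentAt (cmArchSection …) (cmCompactFactor …) ∨ P.IsAntiholCotangentAt …`.  The guarded (C3₀) then
yields β_opp-adm only for COTANGENT-GUARDED `P`, `P′` («β_opp-adm-cot», the text of `StubBetaOppAdm` (CONTRACT v7) with the two guards inserted right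
after the `P P′` binders, in the binder order of ★ `Rogawski1990.hodgeTypeRigid`).  THIS FILE shows that the E2′ consumer loses nothing: in
`hodgeTypeRigid`'s frame `P` IS of holomorphic and `P′` of antiholomorphic cotangent type.
* §1 **`hodgeTypeRigid_of_betaOppAdmCot_cpt (hβc : <β_opp-adm-cot>) (hF1a : <StubF1aCM text VERBATIM>) : Rogawski1990.hodgeTypeRigid`** — ★ K1″
  `F0P3StubBetaOppAdmFold.hodgeTypeRigid_of_betaOppAdm_cpt`'s proof token for token, the guards fed as `Or.inl hP`, `Or.inr hP′`.
* §2 `betaOppAdmCot_of_betaOppAdm` — the unguarded CONTRACT v7 text implies the guarded one (drop the guards), so ED. 3's `stub_betaOpp` still feeds §1.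
No definition, no `sorry`, no named fact asserted (β_opp-adm(-cot), F1a, E2′ appear only as hypothesis ∕ conclusion texts or BY NAME); this file does not
import the line; `--supports stmt-HodgeConjecture-24833 --as helper`.  HONEST LABEL: HC_CM is proved only modulo the printed citations until rung 0 closes.

References: Rogawski 1990, Thm. 13.3.6 (c), Thm. 13.3.5, Thm. 14.6.4 (proof, l. 1), §12.3 p. 178, Prop. 15.2.1 (b), §15.3 ¶1 [Rogawski1990];
Bernstein–Zelevinsky 1976, §2.1 [BernsteinZelevinsky1976]; Borel–Wallach 2000, VI 4.11 [BorelWallach2000]; Flath, Corvallis 1979, Thm. 3 [FlathCorvallis1979].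
-/

-- Mathlib idiom (as in ★ `GKModules`, ★ K1, ★ K1″): commutator bracket on `Module.End ℂ V`
attribute [local instance 100] LieRing.ofAssociativeRing

set_option autoImplicit false
-- the mandated namespace repeats `HodgeConjecture.HodgeConjecture`, as in every `Theorems/*.lean` of this sub-problem
set_option linter.dupNamespace false

noncomputable section

namespace Summit.HodgeConjecture.HodgeConjecture.Cruxes.H413.F0P3HodgeTypeRigidOfBetaOppAdmCot

open NumberField NumberField.InfinitePlace MeasureTheory
open scoped Matrix MatrixGroups ComplexOrder
open Literature.RepresentationTheory.BorelWallach2000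
open Literature.NumberTheory.Automorphic Literature.NumberTheory.Automorphic.UnitaryGroup
open Literature.NumberTheory.Automorphic.UnitaryGroup.CotangentForms
open Literature.RepresentationTheory.KonnoKonno2007 Literature.RepresentationTheory.KonnoKonno2007.RealDualPair
open Literature.RepresentationTheory.KonnoKonno2007.RealDualPair.UForm
open Summit.HodgeConjecture.HodgeConjecture.Cruxes.H413.F0P3HodgeTypeRigidOfArchRigid
open Summit.HodgeConjecture.HodgeConjecture.Cruxes.H413.F0P3HodgeTypeRigidDiag
open Summit.HodgeConjecture.HodgeConjecture.Cruxes.H413.F0P3ValueMapHeads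
open Summit.HodgeConjecture.HodgeConjecture.Cruxes.H413.F0P3ArchIsotypyCM
open Summit.HodgeConjecture.HodgeConjecture.Cruxes.H413.F0P3ValueMapTransport
open Summit.HodgeConjecture.HodgeConjecture.Cruxes.H413.F0P3PNullMapIsCocycle
open Summit.HodgeConjecture.HodgeConjecture.Cruxes.H413.F0P3bArchDegOnePackage
open Summit.HodgeConjecture.HodgeConjecture.Cruxes.H413.F0P3StubE2pFold
open Summit.HodgeConjecture.HodgeConjecture.Cruxes.H413.F0P3StubBetaOppAdmFold (isAdmissible_of_hasFinComponent_of_isHolCotangentAt_cpt)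

/-! ## §1 E2′ from the COTANGENT-GUARDED β_opp-adm + F1a at the pin -/

/-- **Letter E2′ `hodgeTypeRigid` from «β_opp-adm-cot» (CONTRACT v7's `StubBetaOppAdm` with BOTH `P`-binders cotangent-guarded, RULING (V30)(1)) and
`StubF1aCM` in its v5 text.**  Proof = ★ K1″ `hodgeTypeRigid_of_betaOppAdm_cpt` token for token: admissibility of the common finite component read on the
hol-type `P` (★ `isAdmissible_of_hasFinComponent_of_isHolCotangentAt_cpt`); F1a at the pin for `P` (hol) and `P′` (antihol) ⇒ detecting irreducible
`(𝔤, K)`-modules ★ `exists_detecting_irreducible`; the value maps ★ `hVal_hol` ∕ `hVal_antihol` composed with the detecting maps give a type-`(+1)` class on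
`M` and a type-`(−1)` class on `M′` (★ J2 `typeClasses_ne_bot_of_linearMap`); β_opp-adm-cot at `(P, P′)` with the guards `Or.inl hP`, `Or.inr hP′` closes.
[cite: Rogawski1990, Thm. 13.3.6 (c); Thm. 14.6.4 proof l. 1; §12.3 p. 178; Prop. 15.2.1 (b); §15.3 ¶1] [cite: BernsteinZelevinsky1976, §2.1]
[cite: BorelWallach2000, VI Thm. 4.11] [cite: FlathCorvallis1979, Thm. 3] -/
theorem hodgeTypeRigid_of_betaOppAdmCot_cpt
    (hβc :
    ∀ (L : Type) [Field L] [NumberField L] [IsCMField L] (ι : L →+* ℂ) (H : Matrix (Fin 3) (Fin 3) L) (T : GL (Fin 3) ℂ)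
      (hT : (T : Matrix (Fin 3) (Fin 3) ℂ)ᴴ * H.map ι * (T : Matrix (Fin 3) (Fin 3) ℂ) = Literature.Geometry.ComplexHyperbolic.BallModel.J),
      (∀ τ' : L →+* ℂ, InfinitePlace.mk τ' ≠ InfinitePlace.mk ι → (H.map τ').PosDef) →
      2 ≤ Module.finrank ℚ ↥(maximalRealSubfield L) →
      ∀ (μ : Measure (adelicGroupData (↥(maximalRealSubfield L)) L (IsCMField.complexConj L) 3 H).automorphicQuotient)
        [(adelicGroupData (↥(maximalRealSubfield L)) L (IsCMField.complexConj L) 3 H).IsAutomorphicMeasure μ]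
        (W : Type) [AddCommGroup W] [Module ℂ W]
        (σ : Representation ℂ (finAdelic (↥(maximalRealSubfield L)) L (IsCMField.complexConj L) 3 H) W),
        σ.IsIrreducible → σ.IsSmooth → σ.IsAdmissible →
      ∀ (P P' : DiscreteAutomorphicRep (adelicGroupData (↥(maximalRealSubfield L)) L (IsCMField.complexConj L) 3 H) μ),
        (P.IsHolCotangentAt (cmArchSection L ι H T hT) (cmCompactFactor L ι H T hT) ∨
          P.IsAntiholCotangentAt (cmArchSection L ι H T hT) (cmCompactFactor L ι H T hT)) →
        (P'.IsHolCotangentAt (cmArchSection L ι H T hT) (cmCompactFactor L ι H T hT) ∨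
          P'.IsAntiholCotangentAt (cmArchSection L ι H T hT) (cmCompactFactor L ι H T hT)) →
        P.HasFinComponent σ → P'.HasFinComponent σ →
      ∀ (M : Type) [AddCommGroup M] [Module ℂ M] (σK : Representation ℂ (uFormGroup (Fin 2) (Fin 1)).maximalCompact M)
        (σ𝔤 : (uFormGroup (Fin 2) (Fin 1)).lie →ₗ⁅ℝ⁆ Module.End ℂ M) (hM : IsGKModule (uFormGroup (Fin 2) (Fin 1)) σK σ𝔤),
        IsIrreducibleGK σK σ𝔤 →
        (∃ T₁ : P.archModuleCM ι T hT →ₗ[ℂ] M,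
          (∀ (k : (uFormGroup (Fin 2) (Fin 1)).maximalCompact) (w : P.archModuleCM ι T hT),
              T₁ (P.archRepKCM ι T hT k w) = σK k (T₁ w)) ∧
            (∀ (X : (uFormGroup (Fin 2) (Fin 1)).lie) (w : P.archModuleCM ι T hT),
              T₁ (P.archRepLieCM ι T hT X w) = σ𝔤 X (T₁ w)) ∧ T₁ ≠ 0) →
      ∀ (M' : Type) [AddCommGroup M'] [Module ℂ M'] (σK' : Representation ℂ (uFormGroup (Fin 2) (Fin 1)).maximalCompact M')
        (σ𝔤' : (uFormGroup (Fin 2) (Fin 1)).lie →ₗ⁅ℝ⁆ Module.End ℂ M') (hM' : IsGKModule (uFormGroup (Fin 2) (Fin 1)) σK' σ𝔤'),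
        IsIrreducibleGK σK' σ𝔤' →
        (∃ T₂ : P'.archModuleCM ι T hT →ₗ[ℂ] M',
          (∀ (k : (uFormGroup (Fin 2) (Fin 1)).maximalCompact) (w : P'.archModuleCM ι T hT),
              T₂ (P'.archRepKCM ι T hT k w) = σK' k (T₂ w)) ∧
            (∀ (X : (uFormGroup (Fin 2) (Fin 1)).lie) (w : P'.archModuleCM ι T hT),
              T₂ (P'.archRepLieCM ι T hT X w) = σ𝔤' X (T₂ w)) ∧ T₂ ≠ 0) →
        upqTypeClasses σK σ𝔤 hM.ad_compat 1 1 ≠ ⊥ → upqTypeClasses σK' σ𝔤' hM'.ad_compat 1 (-1) ≠ ⊥ → False)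
    (hF1a :
      ∀ (L : Type) [Field L] [NumberField L] [IsCMField L] (ι : L →+* ℂ) (H : Matrix (Fin 3) (Fin 3) L) (T : GL (Fin 3) ℂ)
        (hT : (T : Matrix (Fin 3) (Fin 3) ℂ)ᴴ * H.map ι * (T : Matrix (Fin 3) (Fin 3) ℂ) = Literature.Geometry.ComplexHyperbolic.BallModel.J),
        (∀ τ' : L →+* ℂ, InfinitePlace.mk τ' ≠ InfinitePlace.mk ι → (H.map τ').PosDef) →
        2 ≤ Module.finrank ℚ ↥(maximalRealSubfield L) →
        ∀ (μ : Measure (adelicGroupData (↥(maximalRealSubfield L)) L (IsCMField.complexConj L) 3 H).automorphicQuotient)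
        [(adelicGroupData (↥(maximalRealSubfield L)) L (IsCMField.complexConj L) 3 H).IsAutomorphicMeasure μ]
        (P : DiscreteAutomorphicRep (adelicGroupData (↥(maximalRealSubfield L)) L (IsCMField.complexConj L) 3 H) μ),
        (P.IsHolCotangentAt (cmArchSection L ι H T hT) (cmCompactFactor L ι H T hT) ∨
          P.IsAntiholCotangentAt (cmArchSection L ι H T hT) (cmCompactFactor L ι H T hT)) →
        P.ArchIsotypy (uFormGroup (Fin 2) (Fin 1)) (cmArchSectionUForm L ι H T hT)) :
    Literature.NumberTheory.Rogawski1990.hodgeTypeRigid := by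
  intro L _ _ _ ι H T hT hdef h2 μ _ W _ _ σ hirr hsm P P' hP hP' hfin hfin'
  -- v7's extra input: the common finite component is ADMISSIBLE, read on the hol-type `P` (★ K1″ §1)
  have hadm : σ.IsAdmissible := isAdmissible_of_hasFinComponent_of_isHolCotangentAt_cpt ι T hT hdef h2 μ P hP σ hirr hsm hfin
  -- the cotangent guards of `P` (hol) and `P′` (antihol), kept for β_opp-adm-cot
  have hPc : P.IsHolCotangentAt (cmArchSection L ι H T hT) (cmCompactFactor L ι H T hT) ∨
      P.IsAntiholCotangentAt (cmArchSection L ι H T hT) (cmCompactFactor L ι H T hT) := Or.inl hP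
  have hP'c : P'.IsHolCotangentAt (cmArchSection L ι H T hT) (cmCompactFactor L ι H T hT) ∨
      P'.IsAntiholCotangentAt (cmArchSection L ι H T hT) (cmCompactFactor L ι H T hT) := Or.inr hP'
  -- letter F1a at the pin, for the hol-type `P` and the antihol-type `P′`
  have hIso := hF1a L ι H T hT hdef h2 μ P hPc
  have hIso' := hF1a L ι H T hT hdef h2 μ P' hP'c
  -- the cotangent forms and their value maps (★ B1′ heads)
  obtain ⟨Φ, hΦ, hΦ0, hcont⟩ := hP
  obtain ⟨Ψ, hΨ, hΨ0, hcont'⟩ := hP'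
  obtain ⟨φ, hφ0, h0, hK, h𝔨, hwt, hN⟩ := hVal_hol L ι H T hT hdef h2 μ P Φ hΦ hΦ0 hcont
  obtain ⟨φ', hφ'0, h0', hK', h𝔨', hwt', hN'⟩ := hVal_antihol L ι H T hT hdef h2 μ P' Ψ hΨ hΨ0 hcont'
  -- the detecting irreducible admissible modules (F1a unpacked at the pin) and detecting maps
  obtain ⟨M, _, _, σK, σ𝔤, hGK, hirrM, -, hdet⟩ := exists_detecting_irreducible ι T hT P hIso
  obtain ⟨M', _, _, σK', σ𝔤', hGK', hirrM', -, hdet'⟩ := exists_detecting_irreducible ι T hT P' hIso'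
  obtain ⟨X₀, hX₀⟩ := exists_apply_ne_zero_of_ne_zero hφ0
  obtain ⟨X₁, hX₁⟩ := exists_apply_ne_zero_of_ne_zero hφ'0
  obtain ⟨T₁, hT₁K, hT₁𝔤, hT₁⟩ := hdet _ hX₀
  obtain ⟨T₂, hT₂K, hT₂𝔤, hT₂⟩ := hdet' _ hX₁
  have hT₁0 : T₁ ≠ 0 := fun h => hT₁ (h ▸ rfl)
  have hT₂0 : T₂ ≠ 0 := fun h => hT₂ (h ▸ rfl)
  -- typed value maps on `M`, `M′` and the cohomology classes they give
  have c1 : ((1 : ℤ) : ℂ) = 1 := Int.cast_one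
  have c2 : ((-1 : ℤ) : ℂ) = -1 := by rw [Int.cast_neg, Int.cast_one]
  obtain ⟨q0, qK, q𝔨, qwt, qN⟩ := valueMap_comp (δ := 1) φ T₁ hT₁K hT₁𝔤 h0 hK h𝔨
    (fun X => eq_intCast_mul_I_smul_of_eq_one (V := ↥(P.archModuleCM ι T hT)) c1 (hwt X))
    (fun X s => add_intCast_mul_I_smul_eq_zero_of_eq_one (V := ↥(P.archModuleCM ι T hT)) c1 (hN X s))
  obtain ⟨r0, rK, r𝔨, rwt, rN⟩ := valueMap_comp (δ := -1) φ' T₂ hT₂K hT₂𝔤 h0' hK' h𝔨'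
    (fun X => eq_intCast_mul_I_smul_of_eq_neg_one (V := ↥(P'.archModuleCM ι T hT)) c2 (hwt' X))
    (fun X s => add_intCast_mul_I_smul_eq_zero_of_eq_neg_one (V := ↥(P'.archModuleCM ι T hT)) c2 (hN' X s))
  have hne : upqTypeClasses σK σ𝔤 hGK.ad_compat 1 1 ≠ ⊥ :=
    typeClasses_ne_bot_of_linearMap σK σ𝔤 hGK.ad_compat hirrM (Or.inl rfl) _
      (comp_ne_zero_of_apply_ne_zero φ T₁ hT₁) q0 qK q𝔨 qwt qN
  have hne' : upqTypeClasses σK' σ𝔤' hGK'.ad_compat 1 (-1) ≠ ⊥ :=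
    typeClasses_ne_bot_of_linearMap σK' σ𝔤' hGK'.ad_compat hirrM' (Or.inr rfl) _
      (comp_ne_zero_of_apply_ne_zero φ' T₂ hT₂) r0 rK r𝔨 rwt rN
  -- β_opp-adm-cot: the type-`(+1)` constituent of `P` and the type-`(−1)` constituent of `P′` cannot coexist over the admissible `σ`
  exact (hβc L ι H T hT hdef h2 μ W σ hirr hsm hadm P P' hPc hP'c hfin hfin' M σK σ𝔤 hGK hirrM ⟨T₁, hT₁K, hT₁𝔤, hT₁0⟩ M' σK' σ𝔤' hGK' hirrM'
    ⟨T₂, hT₂K, hT₂𝔤, hT₂0⟩ hne hne').elim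

/-! ## §2 CONTRACT v7 ⇒ β_opp-adm-cot (drop the guards) -/

/-- **β_opp-adm ⇒ β_opp-adm-cot** (the unguarded CONTRACT v7 text implies the cotangent-guarded one: ignore the two guards), so the line's ED. 3 closer
`stub_betaOpp : StubBetaOppAdm` still feeds §1. [cite: Rogawski1990, Thm. 13.3.6 (c); §14.6 Thm. 14.6.4] -/
theorem betaOppAdmCot_of_betaOppAdm
    (hβoa :
    ∀ (L : Type) [Field L] [NumberField L] [IsCMField L] (ι : L →+* ℂ) (H : Matrix (Fin 3) (Fin 3) L) (T : GL (Fin 3) ℂ)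
      (hT : (T : Matrix (Fin 3) (Fin 3) ℂ)ᴴ * H.map ι * (T : Matrix (Fin 3) (Fin 3) ℂ) = Literature.Geometry.ComplexHyperbolic.BallModel.J),
      (∀ τ' : L →+* ℂ, InfinitePlace.mk τ' ≠ InfinitePlace.mk ι → (H.map τ').PosDef) →
      2 ≤ Module.finrank ℚ ↥(maximalRealSubfield L) →
      ∀ (μ : Measure (adelicGroupData (↥(maximalRealSubfield L)) L (IsCMField.complexConj L) 3 H).automorphicQuotient)
        [(adelicGroupData (↥(maximalRealSubfield L)) L (IsCMField.complexConj L) 3 H).IsAutomorphicMeasure μ]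
        (W : Type) [AddCommGroup W] [Module ℂ W]
        (σ : Representation ℂ (finAdelic (↥(maximalRealSubfield L)) L (IsCMField.complexConj L) 3 H) W),
        σ.IsIrreducible → σ.IsSmooth → σ.IsAdmissible →
      ∀ (P P' : DiscreteAutomorphicRep (adelicGroupData (↥(maximalRealSubfield L)) L (IsCMField.complexConj L) 3 H) μ),
        P.HasFinComponent σ → P'.HasFinComponent σ →
      ∀ (M : Type) [AddCommGroup M] [Module ℂ M] (σK : Representation ℂ (uFormGroup (Fin 2) (Fin 1)).maximalCompact M)
        (σ𝔤 : (uFormGroup (Fin 2) (Fin 1)).lie →ₗ⁅ℝ⁆ Module.End ℂ M) (hM : IsGKModule (uFormGroup (Fin 2) (Fin 1)) σK σ𝔤),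
        IsIrreducibleGK σK σ𝔤 →
        (∃ T₁ : P.archModuleCM ι T hT →ₗ[ℂ] M,
          (∀ (k : (uFormGroup (Fin 2) (Fin 1)).maximalCompact) (w : P.archModuleCM ι T hT),
              T₁ (P.archRepKCM ι T hT k w) = σK k (T₁ w)) ∧
            (∀ (X : (uFormGroup (Fin 2) (Fin 1)).lie) (w : P.archModuleCM ι T hT),
              T₁ (P.archRepLieCM ι T hT X w) = σ𝔤 X (T₁ w)) ∧ T₁ ≠ 0) →
      ∀ (M' : Type) [AddCommGroup M'] [Module ℂ M'] (σK' : Representation ℂ (uFormGroup (Fin 2) (Fin 1)).maximalCompact M')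
        (σ𝔤' : (uFormGroup (Fin 2) (Fin 1)).lie →ₗ⁅ℝ⁆ Module.End ℂ M') (hM' : IsGKModule (uFormGroup (Fin 2) (Fin 1)) σK' σ𝔤'),
        IsIrreducibleGK σK' σ𝔤' →
        (∃ T₂ : P'.archModuleCM ι T hT →ₗ[ℂ] M',
          (∀ (k : (uFormGroup (Fin 2) (Fin 1)).maximalCompact) (w : P'.archModuleCM ι T hT),
              T₂ (P'.archRepKCM ι T hT k w) = σK' k (T₂ w)) ∧
            (∀ (X : (uFormGroup (Fin 2) (Fin 1)).lie) (w : P'.archModuleCM ι T hT),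
              T₂ (P'.archRepLieCM ι T hT X w) = σ𝔤' X (T₂ w)) ∧ T₂ ≠ 0) →
        upqTypeClasses σK σ𝔤 hM.ad_compat 1 1 ≠ ⊥ → upqTypeClasses σK' σ𝔤' hM'.ad_compat 1 (-1) ≠ ⊥ → False) :
    ∀ (L : Type) [Field L] [NumberField L] [IsCMField L] (ι : L →+* ℂ) (H : Matrix (Fin 3) (Fin 3) L) (T : GL (Fin 3) ℂ)
      (hT : (T : Matrix (Fin 3) (Fin 3) ℂ)ᴴ * H.map ι * (T : Matrix (Fin 3) (Fin 3) ℂ) = Literature.Geometry.ComplexHyperbolic.BallModel.J),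
      (∀ τ' : L →+* ℂ, InfinitePlace.mk τ' ≠ InfinitePlace.mk ι → (H.map τ').PosDef) →
      2 ≤ Module.finrank ℚ ↥(maximalRealSubfield L) →
      ∀ (μ : Measure (adelicGroupData (↥(maximalRealSubfield L)) L (IsCMField.complexConj L) 3 H).automorphicQuotient)
        [(adelicGroupData (↥(maximalRealSubfield L)) L (IsCMField.complexConj L) 3 H).IsAutomorphicMeasure μ]
        (W : Type) [AddCommGroup W] [Module ℂ W]
        (σ : Representation ℂ (finAdelic (↥(maximalRealSubfield L)) L (IsCMField.complexConj L) 3 H) W),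
        σ.IsIrreducible → σ.IsSmooth → σ.IsAdmissible →
      ∀ (P P' : DiscreteAutomorphicRep (adelicGroupData (↥(maximalRealSubfield L)) L (IsCMField.complexConj L) 3 H) μ),
        (P.IsHolCotangentAt (cmArchSection L ι H T hT) (cmCompactFactor L ι H T hT) ∨
          P.IsAntiholCotangentAt (cmArchSection L ι H T hT) (cmCompactFactor L ι H T hT)) →
        (P'.IsHolCotangentAt (cmArchSection L ι H T hT) (cmCompactFactor L ι H T hT) ∨
          P'.IsAntiholCotangentAt (cmArchSection L ι H T hT) (cmCompactFactor L ι H T hT)) →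
        P.HasFinComponent σ → P'.HasFinComponent σ →
      ∀ (M : Type) [AddCommGroup M] [Module ℂ M] (σK : Representation ℂ (uFormGroup (Fin 2) (Fin 1)).maximalCompact M)
        (σ𝔤 : (uFormGroup (Fin 2) (Fin 1)).lie →ₗ⁅ℝ⁆ Module.End ℂ M) (hM : IsGKModule (uFormGroup (Fin 2) (Fin 1)) σK σ𝔤),
        IsIrreducibleGK σK σ𝔤 →
        (∃ T₁ : P.archModuleCM ι T hT →ₗ[ℂ] M,
          (∀ (k : (uFormGroup (Fin 2) (Fin 1)).maximalCompact) (w : P.archModuleCM ι T hT),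
              T₁ (P.archRepKCM ι T hT k w) = σK k (T₁ w)) ∧
            (∀ (X : (uFormGroup (Fin 2) (Fin 1)).lie) (w : P.archModuleCM ι T hT),
              T₁ (P.archRepLieCM ι T hT X w) = σ𝔤 X (T₁ w)) ∧ T₁ ≠ 0) →
      ∀ (M' : Type) [AddCommGroup M'] [Module ℂ M'] (σK' : Representation ℂ (uFormGroup (Fin 2) (Fin 1)).maximalCompact M')
        (σ𝔤' : (uFormGroup (Fin 2) (Fin 1)).lie →ₗ⁅ℝ⁆ Module.End ℂ M') (hM' : IsGKModule (uFormGroup (Fin 2) (Fin 1)) σK' σ𝔤'),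
        IsIrreducibleGK σK' σ𝔤' →
        (∃ T₂ : P'.archModuleCM ι T hT →ₗ[ℂ] M',
          (∀ (k : (uFormGroup (Fin 2) (Fin 1)).maximalCompact) (w : P'.archModuleCM ι T hT),
              T₂ (P'.archRepKCM ι T hT k w) = σK' k (T₂ w)) ∧
            (∀ (X : (uFormGroup (Fin 2) (Fin 1)).lie) (w : P'.archModuleCM ι T hT),
              T₂ (P'.archRepLieCM ι T hT X w) = σ𝔤' X (T₂ w)) ∧ T₂ ≠ 0) →
        upqTypeClasses σK σ𝔤 hM.ad_compat 1 1 ≠ ⊥ → upqTypeClasses σK' σ𝔤' hM'.ad_compat 1 (-1) ≠ ⊥ → False :=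
  fun L _ _ _ ι H T hT hdef h2 μ _ W _ _ σ hσi hσs hσa P P' _ _ hPσ hP'σ =>
    hβoa L ι H T hT hdef h2 μ W σ hσi hσs hσa P P' hPσ hP'σ

end Summit.HodgeConjecture.HodgeConjecture.Cruxes.H413.F0P3HodgeTypeRigidOfBetaOppAdmCot

end
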